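import Summits.RiemannHypothesis.RiemannHypothesis.Theorems.HandoffDodgerCleanHorizon
import HarnessLib

/-!
# HANDOFF — the DEFICIT INTEGRAL of the dodger: `∫_0^{T′} t·D(t) dt ≥ X³/(18π) − (log T₀ + 1/3)/(6π) − (s+1)X²/2`, `X = πK/b − 1` (rh-explicit, track «HANDOFF», seat prove-2 gen9, ATTEMPT-18 (D-4) calculus)

HONEST FRAMING. Nothing here bears on the truth of RH; this is calculus. The unified cost bound of ATTEMPT-18 (D-4)
(`HandoffDodgerPotential.prod_killed_le_prod_lattice_mul_exp` fed by `HandoffDodgerHorizonGlue.count_sub_latticeCount_le_neg_taper`)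
carries the exponent `−(2/(γ+1)²)·∫_0^{T′} t·D(t)dt` with the tapered deficit
`D(t) = max(0, (T₀/2π)negMulLog(t/T₀) − s − 1)·max(0, min(1, ℓ − t))`, `ℓ = πK/b`. THIS FILE bounds the integral from below by
elementary calculus: on `[1, X]`, `X := ℓ − 1`, the taper is `1` and `D(t) ≥ (t/2π)log(T₀/t) − s − 1`, and
`∫_1^X t·(t/2π)log(T₀/t) dt = F(X) − F(1)` with `F(t) = (1/2π)(t³/3·log(T₀/t) + t³/9)` (`hasDerivAt_deficitMomentPrim`); hence

  `∫_0^{T′} t·D(t) dt ≥ X³/(18π) − (log T₀ + 1/3)/(6π) − (s+1)X²/2`   (`integral_mul_taper_ge`; `1 ≤ X ≤ T₀`, `X + 1 ≤ T′`)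

— the `T³/(18π) = D₁/2` of ATTEMPT-16 Lemma B2 up to lower order. No `sorry`, standard axioms, no definitions.

References: this track (ATTEMPT-16 §3 Lemma B2; ATTEMPT-18 §1 (D-4)).
-/

set_option linter.dupNamespace false

noncomputable section

open Real Set MeasureTheory intervalIntegral

namespace Summit.RiemannHypothesis.RiemannHypothesis.Theorems.Handoff

/-- The primitive of `t·(t/2π)log(T₀/t)`: `F(t) = (1/2π)(t³/3·log(T₀/t) + t³/9)`, `F′(t) = t²/(2π)·log(T₀/t)` (`t > 0`, `T₀ > 0`).
[folklore] -/
theorem hasDerivAt_deficitMomentPrim {T₀ t : ℝ} (hT₀ : 0 < T₀) (ht : 0 < t) :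
    HasDerivAt (fun u : ℝ => 1 / (2 * π) * (u ^ 3 / 3 * Real.log (T₀ / u) + u ^ 3 / 9))
      (t ^ 2 / (2 * π) * Real.log (T₀ / t)) t := by
  have h1 : HasDerivAt (fun u : ℝ => u ^ 3 / 3) (3 * t ^ 2 / 3) t := by
    simpa using (hasDerivAt_pow 3 t).div_const 3
  have h2 : HasDerivAt (fun u : ℝ => Real.log (T₀ / u)) (-(1 / t)) t := by
    have h3 : HasDerivAt (fun u : ℝ => T₀ / u) (-(T₀ / t ^ 2)) t := by
      have h := (hasDerivAt_inv ht.ne').const_mul T₀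
      have e : (fun u : ℝ => T₀ / u) = fun y => T₀ * y⁻¹ := by funext u; rw [div_eq_mul_inv]
      rw [e]
      refine h.congr_deriv ?_
      ring
    have h4 := h3.log (by positivity : T₀ / t ≠ 0)
    refine h4.congr_deriv ?_
    field_simp
  have h5 : HasDerivAt (fun u : ℝ => u ^ 3 / 9) (3 * t ^ 2 / 9) t := by
    simpa using (hasDerivAt_pow 3 t).div_const 9
  have h6 := ((h1.mul h2).add h5).const_mul (1 / (2 * π))
  refine h6.congr_deriv ?_
  field_simp
  ring

/-- **The deficit integral from below.** For `T₀ > 0`, `s ≥ 0`, `ℓ`, with `X := ℓ − 1`, `1 ≤ X ≤ T₀` and `ℓ ≤ T′`: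
`∫_0^{T′} t·D(t) dt ≥ X³/(18π) − (log T₀ + 1/3)/(6π) − (s+1)X²/2` for the tapered deficit
`D(t) = max(0, (T₀/2π)negMulLog(t/T₀) − s − 1)·max(0, min(1, ℓ − t))`. [this track, ATTEMPT-18 (D-4)] -/
theorem integral_mul_taper_ge {T₀ s ℓ T' : ℝ} (hT₀ : 0 < T₀) (hs0 : 0 ≤ s) (hX1 : 1 ≤ ℓ - 1) (hXT₀ : ℓ - 1 ≤ T₀) (hT' : ℓ ≤ T') :
    (ℓ - 1) ^ 3 / (18 * π) - (Real.log T₀ + 1 / 3) / (6 * π) - (s + 1) * (ℓ - 1) ^ 2 / 2 ≤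
      ∫ t in (0 : ℝ)..T', t * (max 0 (T₀ / (2 * π) * negMulLog (t / T₀) - s - 1) * max 0 (min 1 (ℓ - t))) := by
  set X : ℝ := ℓ - 1 with hX
  set D : ℝ → ℝ := fun t => max 0 (T₀ / (2 * π) * negMulLog (t / T₀) - s - 1) * max 0 (min 1 (ℓ - t)) with hD
  have hDc : Continuous fun t : ℝ => t * D t := by
    refine continuous_id.mul (Continuous.mul (continuous_const.max ?_) (continuous_const.max (continuous_const.min (by fun_prop))))
    exact ((continuous_const.mul (continuous_negMulLog.comp (continuous_id.div_const _))).sub continuous_const).sub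
      continuous_const
  have hD0 : ∀ t, 0 ≤ D t := fun t => mul_nonneg (le_max_left _ _) (le_max_left _ _)
  have hint : ∀ a c : ℝ, IntervalIntegrable (fun t : ℝ => t * D t) volume a c := fun a c => hDc.intervalIntegrable a c
  have hnn : ∀ a c : ℝ, 0 ≤ a → a ≤ c → 0 ≤ ∫ t in a..c, t * D t := fun a c ha hac =>
    intervalIntegral.integral_nonneg hac fun t ht => mul_nonneg (ha.trans ht.1) (hD0 t)
  show _ ≤ ∫ t in (0 : ℝ)..T', t * D t
  -- restrict to `[1, X]`
  rw [← integral_add_adjacent_intervals (hint 0 1) (hint 1 T'), ← integral_add_adjacent_intervals (hint 1 X) (hint X T')]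
  have h01 := hnn 0 1 le_rfl zero_le_one
  have hXT := hnn X T' (by linarith) (by linarith)
  -- on `[1, X]`: `t·D(t) ≥ t·((t/2π)log(T₀/t) − s − 1)`
  have hmid : ∫ t in (1 : ℝ)..X, (t ^ 2 / (2 * π) * Real.log (T₀ / t) - (s + 1) * t) ≤ ∫ t in (1 : ℝ)..X, t * D t := by
    refine integral_mono_on hX1 ?_ (hint 1 X) fun t ht => ?_
    · refine ContinuousOn.intervalIntegrable_of_Icc hX1 ?_
      refine ContinuousOn.sub (ContinuousOn.mul (by fun_prop) (ContinuousOn.log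
        (continuousOn_const.div continuousOn_id fun u hu => ne_of_gt (by linarith [hu.1])) fun u hu => ?_)) (by fun_prop)
      have : 0 < u := by linarith [hu.1]
      positivity
    · have htpos : 0 < t := by linarith [ht.1]
      have htaper : max 0 (min 1 (ℓ - t)) = 1 := by
        rw [min_eq_left (by linarith [ht.2]), max_eq_right zero_le_one]
      have hdef : T₀ / (2 * π) * negMulLog (t / T₀) = t / (2 * π) * Real.log (T₀ / t) :=
        (deficit_eq_negMulLog hT₀ htpos).symm
      have hmax : t / (2 * π) * Real.log (T₀ / t) - s - 1 ≤ max 0 (T₀ / (2 * π) * negMulLog (t / T₀) - s - 1) := by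
        rw [hdef]; exact le_max_right _ _
      rw [hD]; dsimp only; rw [htaper, mul_one]
      have : t ^ 2 / (2 * π) * Real.log (T₀ / t) - (s + 1) * t = t * (t / (2 * π) * Real.log (T₀ / t) - s - 1) := by ring
      rw [this]
      exact mul_le_mul_of_nonneg_left hmax htpos.le
  -- evaluate the minorant
  have hprim : ∫ t in (1 : ℝ)..X, (t ^ 2 / (2 * π) * Real.log (T₀ / t) - (s + 1) * t) =
      (1 / (2 * π) * (X ^ 3 / 3 * Real.log (T₀ / X) + X ^ 3 / 9) - (s + 1) * X ^ 2 / 2) -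
        (1 / (2 * π) * (1 ^ 3 / 3 * Real.log (T₀ / 1) + 1 ^ 3 / 9) - (s + 1) * 1 ^ 2 / 2) := by
    refine integral_eq_sub_of_hasDerivAt (f := fun u : ℝ => 1 / (2 * π) * (u ^ 3 / 3 * Real.log (T₀ / u) + u ^ 3 / 9) - (s + 1) * u ^ 2 / 2)
      (fun t ht => ?_) ?_
    · rw [uIcc_of_le hX1] at ht
      have htpos : 0 < t := by linarith [ht.1]
      have h1 := hasDerivAt_deficitMomentPrim hT₀ htpos
      have h2 : HasDerivAt (fun u : ℝ => (s + 1) * u ^ 2 / 2) ((s + 1) * t) t := by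
        have := ((hasDerivAt_pow 2 t).const_mul (s + 1)).div_const 2
        refine this.congr_deriv ?_
        push_cast; ring
      exact h1.sub h2
    · refine ContinuousOn.intervalIntegrable_of_Icc hX1 ?_
      refine ContinuousOn.sub (ContinuousOn.mul (by fun_prop) (ContinuousOn.log
        (continuousOn_const.div continuousOn_id fun u hu => ne_of_gt (by linarith [hu.1])) fun u hu => ?_)) (by fun_prop)
      have : 0 < u := by linarith [hu.1]
      positivity
  rw [hprim] at hmid
  -- `log(T₀/X) ≥ 0`, `log(T₀/1) = log T₀`
  have hlog : 0 ≤ Real.log (T₀ / X) := Real.log_nonneg (by rw [le_div_iff₀ (by linarith)]; linarith)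
  have hX3 : 0 ≤ X ^ 3 / 3 * Real.log (T₀ / X) := by positivity
  rw [div_one] at hmid
  have hπ : 0 < π := Real.pi_pos
  have e1 : 1 / (2 * π) * (X ^ 3 / 3 * Real.log (T₀ / X) + X ^ 3 / 9) ≥ X ^ 3 / (18 * π) := by
    have : 1 / (2 * π) * (X ^ 3 / 3 * Real.log (T₀ / X) + X ^ 3 / 9) = 1 / (2 * π) * (X ^ 3 / 3 * Real.log (T₀ / X)) + X ^ 3 / (18 * π) := by
      field_simp; ring
    rw [this]
    have : 0 ≤ 1 / (2 * π) * (X ^ 3 / 3 * Real.log (T₀ / X)) := by positivity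
    linarith
  have e2 : 1 / (2 * π) * ((1 : ℝ) ^ 3 / 3 * Real.log T₀ + 1 ^ 3 / 9) = (Real.log T₀ + 1 / 3) / (6 * π) := by
    field_simp; ring
  rw [e2, one_pow, mul_one] at hmid
  linarith [hmid, h01, hXT, e1, hs0]

end Summit.RiemannHypothesis.RiemannHypothesis.Theorems.Handoff

end
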